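import Literature.AnabelianGeometry.EtaleTheta.Discharge.Sec2Cor219iiiStdTwistAut
import Literature.AnabelianGeometry.EtaleTheta.ThetaSystemsToyTower
import HarnessLib

/-!
# [EtTh] Cor. 2.19 (iii) with the standard-type clause (F-0652 `MuTwoSetting.Cor219_iii_std`):
# the UNIVERSAL CLOSURE of the typed schema is FALSE — a kernel witness at the χ-twisted model `modelχ`

S. Mochizuki, *The étale theta function and its Frobenioid-theoretic manifestations*, Publ. RIMS **45**
(2009) [EtTh], §2, Cor. 2.19 (iii), PRIMS PDF p. 65 ("(Constant Multiple Rigidity) … an arbitrary automorphism of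
`Π^tp_X` preserves [the collection of classes] up to … some multiple … by an `l`-th root of unity"), proof p. 66
l. 26–33; §1 Def. 1.9 p. 29. [cite: MochizukiEtTh2009, Cor 2.19(iii) p.65]

abc-iut cell, block F (FACT-PROVING WAVE), seat abc-iut-f-151 (gen 2), FACT-LIST row **F-0652**
(`Literature.AnabelianGeometry.EtaleTheta.MuTwoSetting.Cor219_iii_std`, typer abc-iut-L2-t8,
`ThetaSystemsStandard.lean`). PROOF-ONLY companion (no `def`, no instance), sequel of
`Discharge/Sec2Cor219iiiStdTwistAut.lean` (the outer automorphism `Φ` and the tower tools).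

WHAT IS SHOWN. The row is a PARAMETRISED schema — a predicate on `(p, M, E, l, C, Es, τ, hC, hS, ε_Z, S)`. Its
universal closure is refuted at the Kummer-carrying χ-twisted model (abc-iut-f-113 / w5-d140 / L2-t6 lineage, BY NAME):
`p := 5` (so that `√−1 ∈ ℚ_p`), `M := MuTwoSetting.modelχ p` (`Π^tp_X = Γ ⋊_χ G_{ℚ_p}`), `l := 1` (`X̲̲ := X`; the
typed `DoubleUnderline` only asks `l` odd), `Es :=` the factorial levels, `τ :=` any cyclotome tower, `ε_Z := a`, the
TEST CLASS `η̈ := infl κ̈((1+p)⁻¹) · infl log(Ü)` playing `η̈^Θ`, and Def. 1.9 data `S` whose point `τ` is the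
anchored section-point of parameter `1 + p` RE-LABELLED with the coordinate `√−1` (the typed `StandardData` does not
tie `coord` to `evalAt`). There `OrbitsOfStandardType` (unique value `(1+p)⁻¹·(1+p) = 1`) and `IsAdmissibleEpsZ`
HOLD, and the conclusion FAILS for the OUTER bi-continuous automorphism **`Φ : (γ, σ) ↦ (θ_{−1} γ, σ)`**
(`a ↦ a`, `b ↦ b⁻¹`, Galois coordinate fixed): `Φ` acts by `−1` on `Δ_Θ`, fixes inflated Kummer classes and inverts
`log(Ü)`, so `Φ^* η̈ = η̈ · κ̈((1+p)²)`; clause (4) forces `c` to be `κ̈((1+p)^{±2})` up to the orbit's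
`μ₂`-ambiguity (killed by squaring) and coboundaries, and clause (5) (`c^l`, `l = 1`, a coboundary at every level)
forces — by compactness of `Δ_Θ ≅ Ẑ` over the tower and injectivity of the Kummer map — `(1+p)⁴ = 1`, absurd.
Inner automorphisms do NOT do this (abc-iut-f-153's `c = 1` datum). RESULTS: `exists_not_cor219_iii_std` (any
`p ≡ 1 (mod 4)`) and **`MuTwoSetting.not_forall_cor219_iii_std`**. FACT-LIST reading (R5): the row is consumable AT
NAMED INSTANCES only (`MuTwoSetting.cor219_iii_of_std`; genuine theta classes), never ∀-closed.

HONEST FRAMING: a statement about OUR typing at a SEMI-SYNTHETIC model (not the tempered `π₁` of a curve; the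
test class is not the theta class of a Tate curve); refuted-closure ≠ refuted-in-print; nothing of [EtTh] is
asserted or denied; no side is taken on [IUTchIII] Cor. 3.12; typed ≠ proved.
-/

noncomputable section

namespace Literature.AnabelianGeometry.EtaleTheta.SettingModel

open Literature.AnabelianGeometry.SemiGraphs _root_.Topology _root_.Function

variable (p : ℕ) [Fact p.Prime]

section Main

open scoped IsMulCommutative

set_option maxHeartbeats 800000 in
/-- **F-0652 `MuTwoSetting.Cor219_iii_std` FAILS at an explicit instance of its hypothesis structures**
(`p ≡ 1 (mod 4)`, `M := MuTwoSetting.modelχ p`, `l := 1`, the test class `infl κ̈((1+p)⁻¹)·infl log(Ü)`, the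
re-labelled anchored point of parameter `1+p`, any cyclotome tower over the factorial levels): the antecedents
`OrbitsOfStandardType` and `IsAdmissibleEpsZ` hold and the conclusion is violated by the outer automorphism
`(γ, σ) ↦ (θ_{−1} γ, σ)` of `Π^tp_X = Γ ⋊_χ G_{ℚ_p}`. SEMI-SYNTHETIC model; a statement about OUR typing only;
nothing of [EtTh] asserted; no side taken on [IUTchIII] Cor. 3.12. [cite: MochizukiEtTh2009, Cor 2.19(iii) p.65] -/
theorem exists_not_cor219_iii_std (hp : p % 4 = 1) :
    ∃ (E : (MuTwoSetting.modelχ p).toThetaSetting.EtaleThetaData) (C : E.DoubleUnderline 1)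
      (τ : (MuTwoSetting.modelχ p).toThetaSetting.CyclotomeTower 1 ThetaEnvTower.Toy.facLevels)
      (S : (MuTwoSetting.modelχ p).StandardData E.toKummerData),
      MuTwoSetting.OrbitsOfStandardType C (MuTwoSetting.modelχ_compat p) (epsZχ p) S ∧
      (MuTwoSetting.modelχ p).IsAdmissibleEpsZ (epsZχ p) ∧
      ¬ MuTwoSetting.Cor219_iii_std C τ (MuTwoSetting.modelχ_compat p) (ThetaSetting.modelχ_sec2Hyps p)
          (epsZχ p) S := by
  have hC : (ThetaSetting.modelχ p).Compat := MuTwoSetting.modelχ_compat p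
  haveI := hC.GtpYdd_normal
  -- the test class `η̈ := infl κ̈(v⁻¹) · infl log(Ü)`, `v := 1 + p`
  let v : (↥(ThetaSetting.modelχ p).Kdd)ˣ := onePlusP p
  let η : (ThetaSetting.modelχ p).H1 (ThetaSetting.modelχ p).GtpYdd :=
    (ThetaSetting.modelχ p).inflTheta (ThetaSetting.modelχ p).GtpYdd
        ((kummerDataχSec p).kumYdd ((kummerDataχSec p).toKddHat v⁻¹)) *
      (ThetaSetting.modelχ p).inflTheta (ThetaSetting.modelχ p).GtpYdd (kummerDataχSec p).logUdd
  -- a representative `r` of the Kummer class `κ̈(v⁻¹)` on `G_K̈ = G_{ℚ_p}`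
  obtain ⟨r, hr⟩ : ∃ r : contCocycles ((ThetaSetting.modelχ p).toTheta.comp
      (SemidirectProduct.inr : GQp p →* PiTpχ p)) (ThetaSetting.modelχ p).DeltaTheta (ThetaSetting.modelχ p).GKdd,
      (QuotientGroup.mk r : (kummerDataχSec p).KddHat) = (kummerDataχSec p).toKddHat v⁻¹ :=
    QuotientGroup.mk_surjective _
  have hGKdd : ∀ σ : GQp p, σ ∈ (ThetaSetting.modelχ p).GKdd := fun σ => by
    change σ ∈ (ThetaSetting.modelχ p).Kdd.fixingSubgroup; rw [fixingSubgroup_Kdd_modelχ]; trivial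
  have hGK : ∀ σ : GQp p, σ ∈ (ThetaSetting.modelχ p).GK := fun σ => by
    change σ ∈ (⊥ : IntermediateField ℚ_[p] (PadicAlgCl p)).fixingSubgroup
    rw [IntermediateField.fixingSubgroup_bot]; trivial
  -- the cocycle `F₀ = (r ∘ aug) · (c^{ŷ/2} ∘ toTheta)` representing `η̈` on `Π^tp_Ÿ`
  let Kf : PiTpχ p → (ThetaSetting.modelχ p).DeltaTheta := fun x => r.1 ⟨x.right, hGKdd x.right⟩
  let Uf : (ThetaSetting.modelχ p).GtpYdd → (ThetaSetting.modelχ p).DeltaTheta := fun g =>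
    logUddFunχ p ⟨(ThetaSetting.modelχ p).toTheta g.1, ⟨g.1, g.2, rfl⟩⟩
  let F₀ : (ThetaSetting.modelχ p).GtpYdd → (ThetaSetting.modelχ p).DeltaTheta := fun g => Kf g.1 * Uf g
  have hKf_mul : ∀ x y : PiTpχ p,
      Kf (x * y) = Kf x * MulAut.conjNormal ((ThetaSetting.modelχ p).toTheta x) (Kf y) := by
    intro x y
    rw [← conjNormal_toTheta_inr_right p x]
    exact r.2.2 ⟨x.right, hGKdd x.right⟩ ⟨y.right, hGKdd y.right⟩
  have hKf_cont : Continuous Kf :=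
    r.2.1.comp ((Semidirect.continuous_right (isInducing_leftRightχ p)).subtype_mk _)
  have hF₀ : F₀ ∈ contCocycles (ThetaSetting.modelχ p).toTheta (ThetaSetting.modelχ p).DeltaTheta
      (ThetaSetting.modelχ p).GtpYdd := by
    have hUcont : Continuous Uf := (logUddFunχ_mem p).1.comp
      ((((ThetaSetting.modelχ p).continuous_toTheta.comp continuous_subtype_val).subtype_mk _))
    have hUmul : ∀ g h : (ThetaSetting.modelχ p).GtpYdd,
        Uf (g * h) = Uf g * MulAut.conjNormal ((ThetaSetting.modelχ p).toTheta g.1) (Uf h) := by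
      intro g h
      have hU := (logUddFunχ_mem p).2 ⟨(ThetaSetting.modelχ p).toTheta g.1, ⟨g.1, g.2, rfl⟩⟩
        ⟨(ThetaSetting.modelχ p).toTheta h.1, ⟨h.1, h.2, rfl⟩⟩
      have e : (⟨(ThetaSetting.modelχ p).toTheta (g * h).1, ⟨(g * h).1, (g * h).2, rfl⟩⟩ :
          ↥((ThetaSetting.modelχ p).GtpYdd.map (ThetaSetting.modelχ p).toTheta)) =
          ⟨(ThetaSetting.modelχ p).toTheta g.1, ⟨g.1, g.2, rfl⟩⟩ *
            ⟨(ThetaSetting.modelχ p).toTheta h.1, ⟨h.1, h.2, rfl⟩⟩ :=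
        Subtype.ext (map_mul _ _ _)
      show logUddFunχ p _ = logUddFunχ p _ * MulAut.conjNormal ((ThetaSetting.modelχ p).toTheta g.1) (logUddFunχ p _)
      rw [e, hU, MonoidHom.id_apply]
    refine ⟨(hKf_cont.comp continuous_subtype_val).mul hUcont, fun g h => ?_⟩
    show Kf (g.1 * h.1) * Uf (g * h) = Kf g.1 * Uf g * MulAut.conjNormal ((ThetaSetting.modelχ p).toTheta g.1) (Kf h.1 * Uf h)
    rw [hUmul, hKf_mul, map_mul]
    exact mul_mul_mul_comm _ _ _ _
  have hη : η = ContH1.mk F₀ hF₀ := by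
    show (ThetaSetting.modelχ p).inflTheta (ThetaSetting.modelχ p).GtpYdd
        ((kummerDataχSec p).kumYdd ((kummerDataχSec p).toKddHat v⁻¹)) *
      (ThetaSetting.modelχ p).inflTheta (ThetaSetting.modelχ p).GtpYdd (kummerDataχSec p).logUdd = _
    rw [← hr]
    rfl
  have hΔle : (ThetaSetting.modelχ p).DeltaTheta ≤ (ThetaSetting.modelχ p).lDeltaTheta 1 :=
    fun x hx => ⟨x, hx, pow_one x⟩
  -- the étale theta datum of the test class and the trivial choice `X̲̲ := X` (`l = 1`)
  have hEeta : (etaleThetaDataχM p η).etaDd = ContH1.mk F₀ hF₀ := hη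
  obtain ⟨C, hCHuu⟩ := exists_doubleUnderline_one p (etaleThetaDataχM p η)
  have hmemH : ∀ x : PiTpχ p, x ∈ C.Huu := fun x => by rw [hCHuu]; exact Subgroup.mem_top x
  have hle : C.GtpYdduu ≤ (ThetaSetting.modelχ p).GtpYdd := inf_le_left
  -- a cyclotome tower over the factorial levels
  obtain ⟨τ⟩ := modelχ_nonempty_cyclotomeTower p (l := 1) one_pos ThetaEnvTower.Toy.one_mem_facLevels
    ThetaEnvTower.Toy.facLevels_cofinal ThetaEnvTower.Toy.facLevels_total
  -- Def. 1.9 data: the anchored section-point of parameter `v = 1 + p`, RE-LABELLED with the coordinate `√−1`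
  let A : ThetaSetting.AnchoredPoint (kummerDataχSec p) := anchoredPointχ p v (onePlusP_ne_cusp p)
  let τpt : ThetaSetting.NonCuspidalPoint (kummerDataχSec p) :=
    { A.toNonCuspidalPoint with
      coord := sqrtNegOneUnitχ p hp
      coord_ne_cusp := sqrtNegOneUnitχ_ne_cusp p hp }
  let τpt' : ThetaSetting.NonCuspidalPoint (kummerDataχSec p) :=
    { A.toNonCuspidalPoint with
      coord := sqrtNegOneInvUnitχ p hp
      coord_ne_cusp := sqrtNegOneInvUnitχ_ne_cusp p hp }
  let S : (MuTwoSetting.modelχ p).StandardData (etaleThetaDataχM p η).toKummerData :=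
    { sqrtNegOne := sqrtNegOneχ p hp
      sqrtNegOne_mem := sqrtNegOneχ_mem_K p hp
      sqrtNegOne_sq := sqrtNegOneχ_sq p hp
      tau := τpt
      tauInv := τpt'
      tau_coord := coe_sqrtNegOneUnitχ p hp
      tauInv_coord := coe_sqrtNegOneInvUnitχ p hp }
  -- the antecedent `OrbitsOfStandardType`: the unique value of `η̈` at `τ` is `v⁻¹ · v = 1`
  have hstd : MuTwoSetting.OrbitsOfStandardType C (MuTwoSetting.modelχ_compat p) (epsZχ p) S := by
    change (MuTwoSetting.modelχ p).IsOfStandardType (MuTwoSetting.modelχ_compat p) (epsZχ p) S η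
    have hval : MuTwoSetting.valuesAt (M := MuTwoSetting.modelχ p) (MuTwoSetting.modelχ_compat p) (epsZχ p) η τpt =
        {v⁻¹ * A.coord} :=
      valuesAt_eq_singleton_of_thetaOrbit_eq p (MuTwoSetting.modelχ_compat p) (epsZχ p)
        (thetaOrbit_testClass p (MuTwoSetting.modelχ_compat p) v⁻¹) τpt (evalAt_testClass p A v⁻¹)
    have hv1 : v⁻¹ * A.coord = 1 := by rw [coord_anchoredPointχ]; exact inv_mul_cancel v
    rw [hv1] at hval
    refine ⟨MuTwoSetting.valuesAt (M := MuTwoSetting.modelχ p) (MuTwoSetting.modelχ_compat p) (epsZχ p) η τpt,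
      Or.inl rfl, 1, by rw [hval]; exact Set.mem_singleton 1, fun w hw => ?_, Subgroup.one_mem _, Or.inl ?_⟩
    · rw [hval, Set.mem_singleton_iff] at hw
      rw [hw]
    · rfl
  refine ⟨etaleThetaDataχM p η, C, τ, S, hstd, MuTwoSetting.modelχ_isAdmissibleEpsZ p, fun H => ?_⟩
  -- ### the outer automorphism and the induced data `γ`, `γ̄_N := (·)⁻¹`
  obtain ⟨ι, hι⟩ := exists_invAut
  obtain ⟨Φ, hΦl, hΦr⟩ := exists_twistAut p ι hι
  have hιι : ι * ι = 1 := by ext t; rw [MulAut.mul_apply, hι, hι, inv_inv, MulAut.one_apply]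
  have hΦΦ : ∀ g, Φ (Φ g) = g := fun g => by
    apply SemidirectProduct.ext
    · rw [hΦl, hΦl, ← MulAut.mul_apply, ← map_mul, hιι, map_one, MulAut.one_apply]
    · rw [hΦr, hΦr]
  have hΦsymm : ∀ g, Φ.symm g = Φ g := fun g =>
    Φ.injective (by rw [ContinuousMulEquiv.apply_symm_apply, hΦΦ])
  have hmemΦ : ∀ g, g ∈ (ThetaSetting.modelχ p).GtpYdd → Φ g ∈ (ThetaSetting.modelχ p).GtpYdd :=
    twistAut_mem_GtpYdd_iff_aux ι Φ hΦl hΦr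
  let γ : C.Huu ≃ₜ* C.Huu :=
    { toFun := fun g => ⟨Φ g.1, hmemH _⟩
      invFun := fun g => ⟨Φ.symm g.1, hmemH _⟩
      left_inv := fun g => Subtype.ext (Φ.symm_apply_apply g.1)
      right_inv := fun g => Subtype.ext (Φ.apply_symm_apply g.1)
      map_mul' := fun g h => Subtype.ext (map_mul Φ g.1 h.1)
      continuous_toFun := (Φ.continuous.comp continuous_subtype_val).subtype_mk _
      continuous_invFun := (Φ.symm.continuous.comp continuous_subtype_val).subtype_mk _ }
  have hγ : ((ThetaSetting.modelχ p).GtpYdd.subgroupOf C.Huu).map γ.toMulEquiv.toMonoidHom =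
      (ThetaSetting.modelχ p).GtpYdd.subgroupOf C.Huu := by
    ext g
    simp only [Subgroup.mem_map, Subgroup.mem_subgroupOf]
    constructor
    · rintro ⟨h, hh, rfl⟩
      exact hmemΦ _ hh
    · intro hg
      refine ⟨⟨Φ.symm g.1, hmemH _⟩, ?_, Subtype.ext (Φ.apply_symm_apply g.1)⟩
      change Φ.symm g.1 ∈ _
      rw [hΦsymm]
      exact hmemΦ _ hg
  let γμ : ∀ N : ThetaEnvTower.Toy.facLevels, MuN p N ≃* MuN p N := fun N => MulEquiv.inv (MuN p N)
  have hμ : ∀ (N : ThetaEnvTower.Toy.facLevels)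
      (g : (C.thetaEnvTower τ (MuTwoSetting.modelχ_compat p) (ThetaSetting.modelχ_sec2Hyps p)).lDeltaTheta)
      (hg : γ g ∈ (C.thetaEnvTower τ (MuTwoSetting.modelχ_compat p) (ThetaSetting.modelχ_sec2Hyps p)).lDeltaTheta),
      (C.thetaEnvTower τ (MuTwoSetting.modelχ_compat p) (ThetaSetting.modelχ_sec2Hyps p)).thetaMod N ⟨γ g, hg⟩ =
        γμ N ((C.thetaEnvTower τ (MuTwoSetting.modelχ_compat p) (ThetaSetting.modelχ_sec2Hyps p)).thetaMod N g) := by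
    intro N g hg
    change (τ.mod N).red (C.toLDelta ⟨γ g, hg⟩) = ((τ.mod N).red (C.toLDelta g))⁻¹
    rw [← map_inv]
    congr 1
    apply Subtype.ext
    exact toTheta_twistAut_of_mem_ker ι hι Φ hΦl hΦr g.1.1 ((ThetaSetting.modelχ p).lDeltaTheta_le 1 g.2)
  obtain ⟨c, -, -, -, h4, h5⟩ := H hstd (MuTwoSetting.modelχ_isAdmissibleEpsZ p) γ hγ γμ hμ
  -- clause (5), read in `μ_N ⊆ ℚ̄_p` with the Galois action
  have h5' : ∀ N : ThetaEnvTower.Toy.facLevels, ∃ d : MuN p N, ∀ σ : GQp p,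
      (c N ⟨σ, hGK σ⟩ : MuN p N) ^ 1 = d * (galMuN p N σ d)⁻¹ := fun N => by
    obtain ⟨d, hd⟩ := h5 N
    exact ⟨d, fun σ => hd ⟨σ, hGK σ⟩⟩
  -- ### reading the conclusion: coboundaries, the squared identity, the tower, the Kummer class
  let ρ : ∀ N : ThetaEnvTower.Toy.facLevels, (ThetaSetting.modelχ p).DeltaTheta →* MuN p N := fun N =>
    (τ.mod N).red.comp (Subgroup.inclusion hΔle)
  -- the coboundary `∂s(x) = (x·s·x⁻¹)·s⁻¹` of `s ∈ Δ_Θ` (an opaque local with its defining equation)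
  obtain ⟨cob, hcob⟩ : ∃ cob : (ThetaSetting.modelχ p).DeltaTheta → PiTpχ p → (ThetaSetting.modelχ p).DeltaTheta,
      ∀ s x, cob s x = MulAut.conjNormal ((ThetaSetting.modelχ p).toTheta x) s * s⁻¹ := ⟨_, fun _ _ => rfl⟩
  have hcob_mul : ∀ s t x, cob (s * t) x = cob s x * cob t x := by
    intro s t x
    rw [hcob, hcob, hcob, map_mul, mul_inv, mul_mul_mul_comm]
  have hcob_pow : ∀ s x (n : ℕ), cob (s ^ n) x = cob s x ^ n := by
    intro s x n
    rw [hcob, hcob, map_pow, ← inv_pow, mul_pow]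
  have hcob_inv : ∀ s x, cob s⁻¹ x = (cob s x)⁻¹ := by
    intro s x
    rw [hcob, hcob, map_inv, inv_inv, mul_inv, inv_inv]
  have hKΦ : ∀ x, Kf (Φ x) = Kf x := fun x => congrArg r.1 (Subtype.ext (hΦr x))
  -- the global cocycle whose restriction is `F₀²`
  let yΔ : PiTpχ p → (ThetaSetting.modelχ p).DeltaTheta := fun x => deltaThetaCoordχ p (yCoordχ p x)
  let Glob : PiTpχ p → (ThetaSetting.modelχ p).DeltaTheta := fun x => Kf x ^ 2 * yΔ x
  have hchi : ∀ (x : PiTpχ p) (t : ZH), (deltaThetaCoordχ p (chi p x.right t) : (ThetaSetting.modelχ p).DeltaTheta) =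
      MulAut.conjNormal ((ThetaSetting.modelχ p).toTheta x) (deltaThetaCoordχ p t : (ThetaSetting.modelχ p).DeltaTheta) :=
    fun x t => deltaThetaCoordχ_chi p ((ThetaSetting.modelχ p).toTheta x) t
  have hyΔ_mul : ∀ x y, yΔ (x * y) = yΔ x * MulAut.conjNormal ((ThetaSetting.modelχ p).toTheta x) (yΔ y) := by
    intro x y
    show (deltaThetaCoordχ p (yCoordχ p (x * y)) : (ThetaSetting.modelχ p).DeltaTheta) = _
    rw [yCoordχ_mul, map_mul (deltaThetaCoordχ p)]
    show (deltaThetaCoordχ p (yCoordχ p x) : (ThetaSetting.modelχ p).DeltaTheta) *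
        (deltaThetaCoordχ p (chi p x.right (yCoordχ p y)) : (ThetaSetting.modelχ p).DeltaTheta) = _
    rw [hchi]
    rfl
  have hGlob_mul : ∀ x y, Glob (x * y) = Glob x * MulAut.conjNormal ((ThetaSetting.modelχ p).toTheta x) (Glob y) := by
    intro x y
    show Kf (x * y) ^ 2 * yΔ (x * y) = Kf x ^ 2 * yΔ x * MulAut.conjNormal ((ThetaSetting.modelχ p).toTheta x) (Kf y ^ 2 * yΔ y)
    rw [hKf_mul, hyΔ_mul, mul_pow, map_mul (MulAut.conjNormal _), map_pow]
    exact mul_mul_mul_comm _ _ _ _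
  have hF₀sq : ∀ g : (ThetaSetting.modelχ p).GtpYdd, F₀ g ^ 2 = Glob g.1 := by
    intro g
    show (Kf g.1 * Uf g) ^ 2 = Kf g.1 ^ 2 * yΔ g.1
    rw [mul_pow]
    congr 1
    have key : deltaThetaCoordχ p (half ⟨yThetaχ p ((ThetaSetting.modelχ p).toTheta g.1),
        yThetaχ_mem_range_sqHom p ⟨g.1, g.2, rfl⟩⟩) ^ 2 = deltaThetaCoordχ p (yCoordχ p g.1) := by
      rw [← map_pow, half_sq]
      rfl
    exact key
  have hF₀sqx : ∀ (x : PiTpχ p) (hx : x ∈ (ThetaSetting.modelχ p).GtpYdd), F₀ ⟨x, hx⟩ ^ 2 = Glob x :=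
    fun x hx => hF₀sq ⟨x, hx⟩
  -- per level: the conclusion forces `red_N (K⁴ · ∂s⁻¹) = 1` on `Π^tp_Ÿ` for some `s ∈ Δ_Θ`
  have key : ∀ N : ThetaEnvTower.Toy.facLevels, ∃ s : (ThetaSetting.modelχ p).DeltaTheta,
      ∀ x : PiTpχ p, x ∈ (ThetaSetting.modelχ p).GtpYdd → ρ N (Kf x ^ 4 * (cob s x)⁻¹) = 1 := by
    intro N
    -- the reduction of `F₀` is a theta cocycle
    have hval₀ : ∀ g : ↥C.GtpYdduu,
        (((ContH1.resCocycle (ThetaSetting.modelχ p).toTheta (ThetaSetting.modelχ p).DeltaTheta hle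
          ⟨F₀, hF₀⟩).1 g : (ThetaSetting.modelχ p).DeltaTheta) : (ThetaSetting.modelχ p).GtpTheta) ∈
          (ThetaSetting.modelχ p).lDeltaTheta 1 := fun g => hΔle (F₀ ⟨g.1, g.2.1⟩).2
    have hroot : (ContH1.resCocycle (ThetaSetting.modelχ p).toTheta (ThetaSetting.modelχ p).DeltaTheta hle
        ⟨F₀, hF₀⟩) ∈ C.rootCocycles (MuTwoSetting.modelχ_compat p) :=
      ⟨hval₀, ⟨1, hmemH _, by rw [ContH1.conj_one_apply, hEeta]; rfl⟩⟩
    have hθ₀ : C.modN (τ.mod N) _ hval₀ ∈ C.thetaCocycles (MuTwoSetting.modelχ_compat p) (τ.mod N) := ⟨_, hroot, rfl⟩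
    have h4N := h4 N
    rw [Set.ext_iff] at h4N
    obtain ⟨θ₁, hθ₁, heq⟩ := (h4N _).mp ⟨_, hθ₀, rfl⟩
    obtain ⟨f₁, hf₁, rfl⟩ := hθ₁
    -- the class of `f₁` lies in the orbit: `f₁ = σ·F₀|·∂a`
    obtain ⟨σ, -, hσ⟩ := hf₁.2
    have hσ2 : ContH1.mk (ContH1.resCocycle (ThetaSetting.modelχ p).toTheta (ThetaSetting.modelχ p).DeltaTheta
          hle (ContH1.conjCocycle (ThetaSetting.modelχ p).toTheta (ThetaSetting.modelχ p).DeltaTheta σ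
            ⟨F₀, hF₀⟩)).1
        (ContH1.resCocycle (ThetaSetting.modelχ p).toTheta (ThetaSetting.modelχ p).DeltaTheta
          hle (ContH1.conjCocycle (ThetaSetting.modelχ p).toTheta (ThetaSetting.modelχ p).DeltaTheta σ
            ⟨F₀, hF₀⟩)).2 = ContH1.mk f₁.1 f₁.2 := by
      rw [hσ, hEeta]
      rfl
    obtain ⟨a, ha⟩ := (ContH1.mk_eq_mk_iff _ _ _ _ _).mp hσ2
    -- `(f₁ h)² = (F₀ h)² · ∂(Glob σ · a²)(h)`
    have hsq : ∀ (x : PiTpχ p) (hx : x ∈ (ThetaSetting.modelχ p).GtpYdd),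
        f₁.1 ⟨x, ⟨hx, hmemH x⟩⟩ ^ 2 = F₀ ⟨x, hx⟩ ^ 2 * cob (Glob σ * a ^ 2) x := by
      intro x hx
      have hax := inv_mul_eq_iff_eq_mul.mp (ha ⟨x, ⟨hx, hmemH x⟩⟩)
      have hres : (ContH1.resCocycle (ThetaSetting.modelχ p).toTheta (ThetaSetting.modelχ p).DeltaTheta
            hle (ContH1.conjCocycle (ThetaSetting.modelχ p).toTheta (ThetaSetting.modelχ p).DeltaTheta σ
              ⟨F₀, hF₀⟩)).1 ⟨x, ⟨hx, hmemH x⟩⟩ =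
          MulAut.conjNormal ((ThetaSetting.modelχ p).toTheta σ)
            (F₀ (MulAut.conjNormal σ⁻¹ (⟨x, hx⟩ : (ThetaSetting.modelχ p).GtpYdd))) :=
        ContH1.conjCocycle_apply σ ⟨F₀, hF₀⟩ ⟨x, hx⟩
      have hcx : (((MulAut.conjNormal σ⁻¹ (⟨x, hx⟩ : (ThetaSetting.modelχ p).GtpYdd)) :
          (ThetaSetting.modelχ p).GtpYdd) : PiTpχ p) = σ⁻¹ * x * σ := by
        rw [MulAut.conjNormal_apply, inv_inv]
      have hsqF : F₀ (MulAut.conjNormal σ⁻¹ (⟨x, hx⟩ : (ThetaSetting.modelχ p).GtpYdd)) ^ 2 = Glob (σ⁻¹ * x * σ) := by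
        rw [hF₀sq, hcx]
      have hcobx : MulAut.conjNormal ((ThetaSetting.modelχ p).toTheta ((⟨x, ⟨hx, hmemH x⟩⟩ :
          ↥C.GtpYdduu) : PiTpχ p)) a * a⁻¹ = cob a x :=
        (hcob a x).symm
      rw [hax, hres, hcobx, mul_pow, ← map_pow, hsqF, conjNormal_apply_globalCocycle _ _ Glob hGlob_mul σ x,
        ← hcob (Glob σ) x, ← hcob_pow, hF₀sqx, hcob_mul (Glob σ) (a ^ 2) x, mul_assoc]
    -- clause (5): `c_N` is a coboundary, read through `red_N`
    obtain ⟨d, hd⟩ := h5' N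
    obtain ⟨d', hd'⟩ := (τ.mod N).red_surjective d
    let dd : (ThetaSetting.modelχ p).DeltaTheta := ⟨d'.1, (ThetaSetting.modelχ p).lDeltaTheta_le 1 d'.2⟩
    have hρdd : ρ N dd = d := by rw [← hd']; rfl
    have hcN : ∀ x : PiTpχ p, (c N ⟨x.right, hGK _⟩ : MuN p N) = (ρ N (cob dd x))⁻¹ := by
      intro x
      have h := hd x.right
      rw [pow_one] at h
      rw [h]
      have hconj : ρ N (MulAut.conjNormal ((ThetaSetting.modelχ p).toTheta x) dd) = galMuN p N x.right (ρ N dd) :=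
        (τ.mod N).red_conj x (Subgroup.inclusion hΔle dd)
      rw [hcob, map_mul, map_inv, hconj, hρdd, mul_inv_rev, inv_inv]
    -- evaluate clause (4) at `x ∈ Π^tp_Ÿ` and square
    refine ⟨dd ^ 2 * (Glob σ * a ^ 2)⁻¹, fun x hx => ?_⟩
    have hUΦ : Uf ⟨Φ x, hmemΦ x hx⟩ = (Uf ⟨x, hx⟩)⁻¹ := logUddFunχ_twistAut ι hι Φ hΦl x _ _
    have e1 : ρ N (f₁.1 ⟨x, ⟨hx, hmemH x⟩⟩) * (c N ⟨x.right, hGK _⟩ : MuN p N) =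
        (ρ N (Kf (Φ x) * Uf ⟨Φ x, hmemΦ x hx⟩))⁻¹ :=
      congrFun heq ⟨⟨x, hmemH x⟩, hx⟩
    rw [hKΦ, hUΦ, hcN, map_mul, map_inv] at e1
    have e2 : ρ N (f₁.1 ⟨x, ⟨hx, hmemH x⟩⟩) ^ 2 =
        ρ N (Kf x) ^ 2 * ρ N (Uf ⟨x, hx⟩) ^ 2 * ρ N (cob (Glob σ * a ^ 2) x) := by
      rw [← map_pow, hsq x hx, map_mul, map_pow]
      show ρ N (Kf x * Uf ⟨x, hx⟩) ^ 2 * _ = _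
      rw [map_mul, mul_pow]
    have e3 := muN_aux p e1 e2
    rw [inv_pow] at e3
    rw [map_mul, map_pow, map_inv, hcob_mul, map_mul, hcob_pow, map_pow, hcob_inv, map_inv, mul_inv_rev, inv_inv,
      ← mul_assoc]
    exact e3
  -- ### compactness of `Δ_Θ` over the tower: one `s ∈ Δ_Θ` with `K⁴ = ∂s` on `Π^tp_Ÿ` at once
  have hPcont : ∀ x : PiTpχ p, Continuous fun s : (ThetaSetting.modelχ p).DeltaTheta => Kf x ^ 4 * (cob s x)⁻¹ := by
    intro x
    have hconj : Continuous fun s : (ThetaSetting.modelχ p).DeltaTheta =>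
        MulAut.conjNormal ((ThetaSetting.modelχ p).toTheta x) s :=
      continuous_induced_rng.2 (by
        simp only [Function.comp_def, MulAut.conjNormal_apply]
        fun_prop)
    have hcobc : Continuous fun s : (ThetaSetting.modelχ p).DeltaTheta => cob s x := by
      have e : (fun s : (ThetaSetting.modelχ p).DeltaTheta => cob s x) =
          fun s => MulAut.conjNormal ((ThetaSetting.modelχ p).toTheta x) s * s⁻¹ := funext fun s => hcob s x
      rw [e]
      exact hconj.mul continuous_inv
    exact continuous_const.mul hcobc.inv
  obtain ⟨s, hs⟩ := exists_forall_eq_one_of_levelwise p τ (fun s x => Kf x ^ 4 * (cob s x)⁻¹) hPcont key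
  have hK4 : ∀ x : PiTpχ p, x ∈ (ThetaSetting.modelχ p).GtpYdd → Kf x ^ 4 = cob s x :=
    fun x hx => mul_inv_eq_one.mp (hs x hx)
  -- on the Galois section `inr`: `r⁴` is a coboundary, so `κ̈(v⁻¹)⁴ = 1`, so `v⁴ = 1`
  have hcob4 : (r ^ 4).1 ∈ contCoboundaries ((ThetaSetting.modelχ p).toTheta.comp
      (SemidirectProduct.inr : GQp p →* PiTpχ p)) (ThetaSetting.modelχ p).DeltaTheta (ThetaSetting.modelχ p).GKdd := by
    rw [mem_contCoboundaries_iff]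
    refine ⟨s, funext fun g => ?_⟩
    have hg := hK4 (SemidirectProduct.inr g.1) (inr_mem_GtpYdd_modelχ p g.1)
    rw [hcob] at hg
    exact hg
  have hmk4 : (QuotientGroup.mk (r ^ 4) : (kummerDataχSec p).KddHat) = 1 :=
    (ContH1.mk_eq_one_iff _ (r ^ 4).2).mpr hcob4
  have hr4 : (kummerDataχSec p).toKddHat (v⁻¹ ^ 4) = 1 := by
    rw [map_pow, ← hr]
    exact hmk4
  have hv4 : v ^ 4 = 1 := by
    have h := (kummerDataχSec p).toKddHat_injective (hr4.trans (map_one _).symm)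
    rwa [inv_pow, inv_eq_one] at h
  exact onePlusP_pow_four_ne_one p hv4

/-- **The universal closure of FACT-LIST row F-0652 (`MuTwoSetting.Cor219_iii_std`, [EtTh] Cor. 2.19 (iii) with the
standard-type clause, as typed) is FALSE**: at `p = 5`, `M := MuTwoSetting.modelχ 5`, `l := 1` and the test class of
`exists_not_cor219_iii_std` the antecedents hold and the conclusion fails. FACT-LIST reading (R5): the row is a SCHEMA,
consumable at named instances only (`MuTwoSetting.cor219_iii_of_std`), never ∀-closed. HONEST FRAMING: refutes OUR
typed universal closure at a semi-synthetic model; says nothing about [EtTh] Cor. 2.19 (iii) for the tempered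
fundamental group of a Tate curve; no side taken on [IUTchIII] Cor. 3.12. [cite: MochizukiEtTh2009, Cor 2.19(iii) p.65] -/
theorem _root_.Literature.AnabelianGeometry.EtaleTheta.MuTwoSetting.not_forall_cor219_iii_std :
    ¬ ∀ (p : ℕ) [Fact p.Prime] (M : MuTwoSetting p) (E : M.toThetaSetting.EtaleThetaData) (l : ℕ)
        (C : E.DoubleUnderline l) (Es : Set ℕ+) (τ : M.toThetaSetting.CyclotomeTower l Es)
        (hC : M.toThetaSetting.Compat) (hS : M.toThetaSetting.Sec2Hyps) (εZ : M.GtpC)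
        (S : M.StandardData E.toKummerData), MuTwoSetting.Cor219_iii_std C τ hC hS εZ S := by
  intro h
  haveI : Fact (Nat.Prime 5) := ⟨by norm_num⟩
  obtain ⟨E, C, τ, S, -, -, hnot⟩ := exists_not_cor219_iii_std 5 (by norm_num)
  exact hnot (h 5 _ E 1 C _ τ _ _ _ S)


end Main

end Literature.AnabelianGeometry.EtaleTheta.SettingModel

end
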